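import Mathlib
import HarnessLib

/-!
# ℤ9 SPECIMEN (peeled `𝔸⁴/ℤ9`, char 3), brick Z4T part 1: the TWISTED `μ₄` ROOT CHART of the
# piece `P_T = D₊(N₁⁷t³)` — twisted substitution `ψ_T`, the lifted action `σ̃` (laws, existence,
# `ψ_T ∘ σ̄ = σ̃ ∘ ψ_T`, `σ̃³ = 1`)
(crux stmt-ResolutionOfSingularities-15640 `WildQuotients.WildQuotientResolution`, line `Sketch`; S1 =
stmt-ResolutionOfSingularities-17941 `CyclicQuotientFourfolds`, non-linear sector; chain w45c card-P
specimen «peeled 𝔸⁴/ℤ9», variant V-BR — res-L1-w45c-idea-2 design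
`L/res-L1-w45c-idea-2/cardP_g12/Z4T-TWIST.md` 75f51c076580e517 §2, res-L1-w45c-plan-1 GO
2026-08-27T16:29:20Z, CHAIN v9.3 §4 «Z4T = stub-2», res-L1-w45c-stub-2 SIG 17:39:44Z. [OURS · L1 W4.5c] —
NOT a statement of any manuscript; replaces the role of no printed item; AI-produced, kernel-checked ≠
expert-reviewed. Def-free, LAW-BASED.)

SETTING (letters of res-L1-w45c-stub-1's Z0 / res-D-pv-033's Z2–Z3). `k` a field, `k[x] = k[x₁,…,xₙ]`,
indices `a b c d` (`x_a, x_b, x_c` = the `J₃`-type coordinates of the peeled action, `x_d` = the peel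
coordinate `w`), the peeled automorphism `σ̄`: `x_b ↦ x_b + x_a`, `x_c ↦ x_c + x_b`,
`x_d ↦ x_d + x_c³ − x_a²x_c`, all other variables (in particular `x_a`) fixed. TWISTED ROOT SLOTS reuse
`k[x]`: `S ↔ X b`, `α ↔ X a`, `γ ↔ X c`, `w ↔ X d`; `u := 1 − S⁶α²`, `v := 1 + S³α`, `v' := 1 − S³α`
(`u = v·v'`); the twisted root chart ring is `L := k[x][u⁻¹]` (`Localization.Away u`, an OPEN SUBSET
of `𝔸ⁿ`), `ι : k[x] → L`, `J := u⁻¹ ∈ L`, `iv := ι v'·J = (ι v)⁻¹`, `iv' := ι v·J = (ι v')⁻¹`.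

* `ψ_T` (the twisted substitution, POLYNOMIAL): `x_a ↦ S⁷αu`, `x_b ↦ S⁴u`, `x_c ↦ Sγ`, `x_d ↦ x_d`,
  passengers fixed (memo §2: `A = x_a/x_b ↦ S³α`; `twist_N1`: `N₁ = x_b(x_b+x_a)(x_b−x_a) ↦ (S³u)⁴` —
  the chart adjoins the FOURTH ROOT of the invariant norm `N₁`).
* LAWS of a lift `τ : L →ₐ[k] L` of `σ̄` (division-free): `τ (ι S) = ι (S·v)`, `τ (ι α) = ι α · iv⁴`,
  `τ (ι γ) = ι γ · iv + ι (S³ v')`, `τ (ι w) = ι (w + S³γ³ − S¹⁵α²u²γ)`, passengers fixed.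
* `lift_apply_v/_v'/_u/_iv/_iv'` (`τ v = v'/v`, `τ v' = 1/v`, `τ u = v'/v²`, char 3),
  **`lift_comp_twist`** (`τ (ι (ψ_T F)) = ι (ψ_T (σ̄ F))`: the four identities of memo §2),
  and — in the companion file `…Z9PeeledTwistedLiftCube` (400-line cap) — `lift_cube_eq_id`
  (`τ³ = id`, given `σ̄³ = 1`), `exists_twistedLift` (`σ̃ : L ≃ₐ[k] L` with the laws and `σ̃ ^ 3 = 1`),
  `twistedLift_ne_one`.
Characteristic `3` enters exactly at `v² − S⁶α² = v'` (`1 + 2S³α = 1 − S³α`).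
Part 2 (`…Z9PeeledTwistedKL`): `σ̃z − z ∈ (S³)`, the unit certificate, K–L ⇒ `L^{σ̃}` regular.
ENGINEERING: every law is an explicit THEOREM binder (a `variable` whose type uses a file-local
`notation3` elaborates to `sorry` inside theorems on the farm — res-L1-w45c-stub-2 16:06:49Z); inside
proofs only `map_mul`/`map_pow` are used as simp lemmas so that `ι v`, `ι v'`, `ι u` stay atoms, and the
identities are closed by `linear_combination` over the relations `ι v·(ι v'·J) = 1`, `ι u = ι v·ι v'`,
`ι v = 1 + (ι S)³ ι α`, `ι v' = 1 − (ι S)³ ι α`, `3 = 0` (cofactors machine-checked off-line).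
-/

-- single-problem summit: the doubled namespace component `ResolutionOfSingularities` is forced
set_option linter.dupNamespace false

noncomputable section

open MvPolynomial

namespace Summit.ResolutionOfSingularities.ResolutionOfSingularities.Theorems.WildQuotientResolution.Z9Peeled

variable (k : Type) [Field k] (n : ℕ) (a b c d : Fin n)

/-- `u = 1 − S⁶α²` (local shorthand; slots `S = X b`, `α = X a`). -/
local notation3 "uT" => (1 - X b ^ 6 * X a ^ 2 : MvPolynomial (Fin n) k)
/-- `v = 1 + S³α` (local shorthand). -/
local notation3 "vT" => (1 + X b ^ 3 * X a : MvPolynomial (Fin n) k)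
/-- `v' = 1 − S³α` (local shorthand). -/
local notation3 "vT'" => (1 - X b ^ 3 * X a : MvPolynomial (Fin n) k)
/-- The twisted root chart ring `L = k[x][u⁻¹]` (local shorthand). -/
local notation3 "LT" => Localization.Away (1 - X b ^ 6 * X a ^ 2 : MvPolynomial (Fin n) k)
/-- `ι : k[x] → L` (local shorthand). -/
local notation3 "ιT" => algebraMap (MvPolynomial (Fin n) k)
  (Localization.Away (1 - X b ^ 6 * X a ^ 2 : MvPolynomial (Fin n) k))
/-- `J = u⁻¹ ∈ L` (local shorthand). -/
local notation3 "JT" => (IsLocalization.Away.invSelf (1 - X b ^ 6 * X a ^ 2 : MvPolynomial (Fin n) k) :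
  Localization.Away (1 - X b ^ 6 * X a ^ 2 : MvPolynomial (Fin n) k))
/-- `iv = (ι v)⁻¹ = ι v'·J` (local shorthand). -/
local notation3 "ivT" => (algebraMap (MvPolynomial (Fin n) k)
  (Localization.Away (1 - X b ^ 6 * X a ^ 2 : MvPolynomial (Fin n) k)) (1 - X b ^ 3 * X a) *
    (IsLocalization.Away.invSelf (1 - X b ^ 6 * X a ^ 2 : MvPolynomial (Fin n) k) :
      Localization.Away (1 - X b ^ 6 * X a ^ 2 : MvPolynomial (Fin n) k)))
/-- `iv' = (ι v')⁻¹ = ι v·J` (local shorthand). -/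
local notation3 "ivT'" => (algebraMap (MvPolynomial (Fin n) k)
  (Localization.Away (1 - X b ^ 6 * X a ^ 2 : MvPolynomial (Fin n) k)) (1 + X b ^ 3 * X a) *
    (IsLocalization.Away.invSelf (1 - X b ^ 6 * X a ^ 2 : MvPolynomial (Fin n) k) :
      Localization.Away (1 - X b ^ 6 * X a ^ 2 : MvPolynomial (Fin n) k)))
/-- The twisted substitution `ψ_T` (local shorthand): `x_a ↦ S⁷αu`, `x_b ↦ S⁴u`, `x_c ↦ Sγ`, rest fixed. -/
local notation3 "twT" => (fun i : Fin n => if i = a then X b ^ 7 * X a * (1 - X b ^ 6 * X a ^ 2)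
    else if i = b then X b ^ 4 * (1 - X b ^ 6 * X a ^ 2) else if i = c then X b * X c
    else (X i : MvPolynomial (Fin n) k))

/-! ## The twisted substitution `ψ_T` -/

/-- `ψ_T (x_a) = S⁷αu`. [OURS · L1 W4.5c] -/
theorem twist_X_a : aeval twT (X a : MvPolynomial (Fin n) k) = X b ^ 7 * X a * uT := by
  rw [aeval_X]; simp

/-- `ψ_T (x_b) = S⁴u`. [OURS · L1 W4.5c] -/
theorem twist_X_b (hab : a ≠ b) : aeval twT (X b : MvPolynomial (Fin n) k) = X b ^ 4 * uT := by
  rw [aeval_X]; simp [hab.symm]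

/-- `ψ_T (x_c) = Sγ`. [OURS · L1 W4.5c] -/
theorem twist_X_c (hac : a ≠ c) (hbc : b ≠ c) :
    aeval twT (X c : MvPolynomial (Fin n) k) = X b * X c := by
  rw [aeval_X]; simp [hac.symm, hbc.symm]

/-- `ψ_T (x_i) = x_i` for `i ∉ {a, b, c}` (in particular for the peel coordinate `x_d`).
[OURS · L1 W4.5c] -/
theorem twist_X_of_ne {i : Fin n} (hia : i ≠ a) (hib : i ≠ b) (hic : i ≠ c) :
    aeval twT (X i : MvPolynomial (Fin n) k) = X i := by
  rw [aeval_X]; simp [hia, hib, hic]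

/-- **`ψ_T (N₁) = (S³u)⁴`** for the invariant norm `N₁ = x_b(x_b + x_a)(x_b − x_a)`: the twisted chart
adjoins the FOURTH ROOT `S³u` of `N₁` (memo §2/§3). [OURS · L1 W4.5c] -/
theorem twist_N1 (hab : a ≠ b) :
    aeval twT (X b * (X b + X a) * (X b - X a) : MvPolynomial (Fin n) k) = (X b ^ 3 * uT) ^ 4 := by
  simp only [map_mul, map_add, map_sub, twist_X_a, twist_X_b k n a b c hab]
  ring

/-! ## The relations of `L`: `v`, `v'` divide `u` -/

/-- `u = v·v'`. [folklore] -/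
theorem u_eq_v_mul_v' : uT = vT * vT' := by ring

/-- `ι u = ι v · ι v'`. [folklore] -/
theorem algebraMap_u_eq : ιT uT = ιT vT * ιT vT' := by rw [← map_mul, ← u_eq_v_mul_v']

/-- `ι v · iv = 1`, i.e. `ι v · (ι v' · J) = 1`. [folklore] -/
theorem algebraMap_v_mul_iv : ιT vT * ivT = 1 := by
  rw [← mul_assoc, ← map_mul, ← u_eq_v_mul_v']
  exact IsLocalization.Away.mul_invSelf _

/-- `ι v' · iv' = 1`. [folklore] -/
theorem algebraMap_v'_mul_iv' : ιT vT' * ivT' = 1 := by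
  rw [← mul_assoc, ← map_mul, show vT' * vT = uT by ring]
  exact IsLocalization.Away.mul_invSelf _

/-- `ι u · J = 1`. [folklore] -/
theorem algebraMap_u_mul_J : ιT uT * JT = 1 := IsLocalization.Away.mul_invSelf _

/-- `ι v = 1 + (ι S)³ ι α`. [folklore] -/
theorem algebraMap_v_eq : ιT vT = 1 + ιT (X b) ^ 3 * ιT (X a) := by
  rw [map_add, map_one, map_mul, map_pow]

/-- `ι v' = 1 − (ι S)³ ι α`. [folklore] -/
theorem algebraMap_v'_eq : ιT vT' = 1 - ιT (X b) ^ 3 * ιT (X a) := by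
  rw [map_sub, map_one, map_mul, map_pow]

/-- `(3 : L) = 0` in characteristic `3`. [folklore] -/
theorem three_eq_zero_L [CharP k 3] : (3 : LT) = 0 := by
  have h : (3 : MvPolynomial (Fin n) k) = 0 := by
    have := CharP.cast_eq_zero (MvPolynomial (Fin n) k) 3
    simpa using this
  have h' := congrArg ιT h
  rwa [map_ofNat, map_zero] at h'

/-! ## Laws of a lift and their consequences
The laws are repeated as explicit binders of every theorem (see the ENGINEERING note). -/

/-- `τ (ι v) = ι v' · iv` (char 3). [OURS · L1 W4.5c] -/
theorem lift_apply_v [CharP k 3] (τ : LT →ₐ[k] LT)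
    (hS : τ (ιT (X b)) = ιT (X b * vT)) (hA : τ (ιT (X a)) = ιT (X a) * ivT ^ 4) :
    τ (ιT vT) = ιT vT' * ivT := by
  have hJ := algebraMap_v_mul_iv k n a b
  have hV := algebraMap_v_eq k n a b
  have hV' := algebraMap_v'_eq k n a b
  have h3 := three_eq_zero_L k n a b
  simp only [map_mul] at hS
  have e : τ (ιT vT) = τ (1 + ιT (X b) ^ 3 * ιT (X a)) := by rw [algebraMap_v_eq]
  rw [e, map_add, map_one, map_mul, map_pow, hS, hA]
  linear_combination (2 + ιT (X b) ^ 3 * ιT (X a) * ivT *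
      ((ιT vT * ivT) ^ 2 + ιT vT * ivT + 1)) * hJ - (2 * ivT) * hV - ivT * hV' +
    (1 - ivT) * h3

/-- `τ (ι v') = iv`. [OURS · L1 W4.5c] -/
theorem lift_apply_v' (τ : LT →ₐ[k] LT)
    (hS : τ (ιT (X b)) = ιT (X b * vT)) (hA : τ (ιT (X a)) = ιT (X a) * ivT ^ 4) :
    τ (ιT vT') = ivT := by
  have hJ := algebraMap_v_mul_iv k n a b
  have hV := algebraMap_v_eq k n a b
  simp only [map_mul] at hS
  have e : τ (ιT vT') = τ (1 - ιT (X b) ^ 3 * ιT (X a)) := by rw [algebraMap_v'_eq]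
  rw [e, map_sub, map_one, map_mul, map_pow, hS, hA]
  linear_combination (-1 - ιT (X b) ^ 3 * ιT (X a) * ivT *
      ((ιT vT * ivT) ^ 2 + ιT vT * ivT + 1)) * hJ + ivT * hV

/-- `τ (ι u) = ι v' · iv²` (char 3). [OURS · L1 W4.5c] -/
theorem lift_apply_u [CharP k 3] (τ : LT →ₐ[k] LT)
    (hS : τ (ιT (X b)) = ιT (X b * vT)) (hA : τ (ιT (X a)) = ιT (X a) * ivT ^ 4) :
    τ (ιT uT) = ιT vT' * ivT ^ 2 := by
  rw [algebraMap_u_eq, map_mul, lift_apply_v k n a b τ hS hA, lift_apply_v' k n a b τ hS hA]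
  ring

/-- `τ iv = ι v · iv'` (char 3). [OURS · L1 W4.5c] -/
theorem lift_apply_iv [CharP k 3] (τ : LT →ₐ[k] LT)
    (hS : τ (ιT (X b)) = ιT (X b * vT)) (hA : τ (ιT (X a)) = ιT (X a) * ivT ^ 4) :
    τ ivT = ιT vT * ivT' := by
  have hJ := algebraMap_v_mul_iv k n a b
  have h2 := algebraMap_v'_mul_iv' k n a b
  have e1 : τ (ιT vT) * τ ivT = 1 := by rw [← map_mul, hJ, map_one]
  rw [lift_apply_v k n a b τ hS hA] at e1
  linear_combination (ιT vT * ivT') * e1 - (τ ivT * (ιT vT' * ivT')) * hJ - τ ivT * h2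

/-- `τ iv' = ι v`. [OURS · L1 W4.5c] -/
theorem lift_apply_iv' (τ : LT →ₐ[k] LT)
    (hS : τ (ιT (X b)) = ιT (X b * vT)) (hA : τ (ιT (X a)) = ιT (X a) * ivT ^ 4) :
    τ ivT' = ιT vT := by
  have hJ := algebraMap_v_mul_iv k n a b
  have h2 := algebraMap_v'_mul_iv' k n a b
  have e1 : τ (ιT vT') * τ ivT' = 1 := by rw [← map_mul, h2, map_one]
  rw [lift_apply_v' k n a b τ hS hA] at e1
  linear_combination (ιT vT) * e1 - τ ivT' * hJ

/-! ## `ψ_T ∘ σ̄ = σ̃ ∘ ψ_T` -/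

/-- On `x_a`: `τ (ι (S⁷αu)) = ι (S⁷αu)`. [OURS · L1 W4.5c] -/
theorem lift_twist_X_a [CharP k 3] (τ : LT →ₐ[k] LT)
    (hS : τ (ιT (X b)) = ιT (X b * vT)) (hA : τ (ιT (X a)) = ιT (X a) * ivT ^ 4) :
    τ (ιT (X b ^ 7 * X a * uT)) = ιT (X b ^ 7 * X a * uT) := by
  have hJ := algebraMap_v_mul_iv k n a b
  have hU := algebraMap_u_eq k n a b
  have hu := lift_apply_u k n a b τ hS hA
  simp only [map_mul, map_pow] at hS ⊢
  rw [hS, hA, hu]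
  linear_combination (ιT (X b) ^ 7 * ιT (X a) * ιT vT' * ιT vT *
    ((ιT vT * ivT) ^ 5 + (ιT vT * ivT) ^ 4 + (ιT vT * ivT) ^ 3 + (ιT vT * ivT) ^ 2 +
      ιT vT * ivT + 1)) * hJ - (ιT (X b) ^ 7 * ιT (X a)) * hU

/-- On `x_b`: `τ (ι (S⁴u)) = ι (S⁴u + S⁷αu)`. [OURS · L1 W4.5c] -/
theorem lift_twist_X_b [CharP k 3] (τ : LT →ₐ[k] LT)
    (hS : τ (ιT (X b)) = ιT (X b * vT)) (hA : τ (ιT (X a)) = ιT (X a) * ivT ^ 4) :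
    τ (ιT (X b ^ 4 * uT)) = ιT (X b ^ 4 * uT + X b ^ 7 * X a * uT) := by
  have hJ := algebraMap_v_mul_iv k n a b
  have hU := algebraMap_u_eq k n a b
  have hV := algebraMap_v_eq k n a b
  have hu := lift_apply_u k n a b τ hS hA
  rw [map_add]
  simp only [map_mul, map_pow] at hS ⊢
  rw [hS, hu]
  linear_combination (ιT (X b) ^ 4 * ιT vT' * ιT vT ^ 2 * (ιT vT * ivT + 1)) * hJ +
    (ιT (X b) ^ 4 * ιT vT' * ιT vT) * hV - (ιT (X b) ^ 4 + ιT (X b) ^ 7 * ιT (X a)) * hU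

/-- On `x_c`: `τ (ι (Sγ)) = ι (Sγ + S⁴u)`. [OURS · L1 W4.5c] -/
theorem lift_twist_X_c (τ : LT →ₐ[k] LT)
    (hS : τ (ιT (X b)) = ιT (X b * vT)) (hG : τ (ιT (X c)) = ιT (X c) * ivT + ιT (X b ^ 3 * vT')) :
    τ (ιT (X b * X c)) = ιT (X b * X c + X b ^ 4 * uT) := by
  have hJ := algebraMap_v_mul_iv k n a b
  have hU := algebraMap_u_eq k n a b
  rw [map_add]
  simp only [map_mul, map_pow] at hS hG ⊢
  rw [hS, hG]
  linear_combination (ιT (X b) * ιT (X c)) * hJ - (ιT (X b) ^ 4) * hU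

-- the induction over `k[x]` with the substitution lambda in the motive needs head-room
set_option maxHeartbeats 1600000 in
/-- **`ψ_T ∘ σ̄ = σ̃ ∘ ψ_T`**: `τ (ι (ψ_T F)) = ι (ψ_T (σ̄ F))` for every `F`. [OURS · L1 W4.5c] -/
theorem lift_comp_twist [CharP k 3] (σ : MvPolynomial (Fin n) k ≃ₐ[k] MvPolynomial (Fin n) k)
    (hb : σ (X b) = X b + X a) (hc : σ (X c) = X c + X b)
    (hd : σ (X d) = X d + X c ^ 3 - X a ^ 2 * X c)
    (hσ : ∀ i, i ≠ b → i ≠ c → i ≠ d → σ (X i) = X i)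
    (hab : a ≠ b) (hac : a ≠ c) (had : a ≠ d) (hbc : b ≠ c) (hbd : b ≠ d) (hcd : c ≠ d)
    (τ : LT →ₐ[k] LT)
    (hS : τ (ιT (X b)) = ιT (X b * vT)) (hA : τ (ιT (X a)) = ιT (X a) * ivT ^ 4)
    (hG : τ (ιT (X c)) = ιT (X c) * ivT + ιT (X b ^ 3 * vT'))
    (hW : τ (ιT (X d)) = ιT (X d + X b ^ 3 * X c ^ 3 - X b ^ 15 * X a ^ 2 * uT ^ 2 * X c))
    (hfix : ∀ i, i ≠ a → i ≠ b → i ≠ c → i ≠ d → τ (ιT (X i)) = ιT (X i))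
    (F : MvPolynomial (Fin n) k) :
    τ (ιT (aeval twT F)) = ιT (aeval twT (σ F)) := by
  have ha : σ (X a) = X a := hσ a hab hac had
  -- the variables
  have hX : ∀ i : Fin n, τ (ιT (aeval twT (X i : MvPolynomial (Fin n) k))) =
      ιT (aeval twT (σ (X i))) := by
    intro i
    by_cases hia : i = a
    · rw [hia, ha, twist_X_a]
      exact lift_twist_X_a k n a b τ hS hA
    by_cases hib : i = b
    · rw [hib, hb, map_add (aeval (R := k) twT), twist_X_a, twist_X_b k n a b c hab]
      exact lift_twist_X_b k n a b τ hS hA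
    by_cases hic : i = c
    · rw [hic, hc, map_add (aeval (R := k) twT), twist_X_c k n a b c hac hbc, twist_X_b k n a b c hab]
      exact lift_twist_X_c k n a b c τ hS hG
    by_cases hid : i = d
    · rw [hid, hd, map_sub (aeval (R := k) twT), map_add (aeval (R := k) twT),
        map_mul (aeval (R := k) twT), map_pow (aeval (R := k) twT), map_pow (aeval (R := k) twT),
        twist_X_c k n a b c hac hbc, twist_X_a, twist_X_of_ne k n a b c had.symm hbd.symm hcd.symm, hW]
      exact congrArg ιT (by ring)
    · rw [hσ i hib hic hid, twist_X_of_ne k n a b c hia hib hic, hfix i hia hib hic hid]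
  -- both sides are `k`-algebra maps `k[x] → L`
  let ιA : MvPolynomial (Fin n) k →ₐ[k] LT := IsScalarTower.toAlgHom k (MvPolynomial (Fin n) k) LT
  let Φ₁ : MvPolynomial (Fin n) k →ₐ[k] LT := τ.comp (ιA.comp (aeval twT))
  let Φ₂ : MvPolynomial (Fin n) k →ₐ[k] LT :=
    (ιA.comp (aeval twT)).comp (σ : MvPolynomial (Fin n) k →ₐ[k] MvPolynomial (Fin n) k)
  have hΦ : Φ₁ = Φ₂ := MvPolynomial.algHom_ext fun i => hX i
  exact DFunLike.congr_fun hΦ F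

end Summit.ResolutionOfSingularities.ResolutionOfSingularities.Theorems.WildQuotientResolution.Z9Peeled

end
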